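import Mathlib
import Summits.MatrixMultiplication.MatrixMultiplication.Theses.NilpotentLieHosts
import Summits.MatrixMultiplication.MatrixMultiplication.Theorems.NilpotentLieHostsUnitriangularCostShapeStubProductModel
import Summits.MatrixMultiplication.MatrixMultiplication.Theorems.NilpotentLieHostsUnitriangularCostShapeStubModelHosts
import Summits.MatrixMultiplication.MatrixMultiplication.Theorems.NilpotentLieHostsUnitriangularCostShapeStubTruncatedMatrixCost

/-!
# Route `NilpotentLieHosts` — crux `UnitriangularCostShape` (stmt-MatrixMultiplication-7724), PROVED

Card C2 of the route (cost numerology of the unitriangular tower): for every `d ≥ 3` there are `b > 0` and `C`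
with `(|X||Y||Z|)^(ω/3) ≤ C (s+1)^(((D-b)/2)·ω + b)`, `D = d(d-1)/2`, for every TPP triple in `U_d(ℤ)` with
separating polynomials of `(j-i)`-weighted degree `≤ s`.  Here `b = ⌊d/2⌋` (the index of `u_d`), as conjectured.

This is the composition `UnitriangularCostShape_of` of the line `registered`
(`Cruxes/UnitriangularCostShape/Lines/birth.lean`) with its three registered stubs, all landed:

* `stub_productModel` (`…StubProductModel.lean`, with the eleven `ProductModel` parts): the Weyl-type product
  model — the truncated polynomial Kirillov family ("oscillator tower") of `U_d` over the truncated Casimir ring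
  `ℂ[z_1..z_k]/(z_i^t)`, `k = ⌊d/2⌋`, `t = (d-1)s+1`, `N = t^q` generators (`2q + k = D`), lifted to
  `M_N(ℂ[z]/(z^t))`, whose products are read by linear functionals (faithfulness up to weight `s` = the span
  theorem);
* `stub_modelHosts` (`…StubModelHosts.lean`): a product model plus separating polynomials hosts `⟨|X|,|Y|,|Z|⟩`
  (BCGPU24 Thm 2.2 / Rem 2.4 mechanism);
* `stub_truncatedMatrixCost` (`…StubTruncatedMatrixCost.lean`): hosting in `M_N(ℂ[z_1..z_k]/(z_i^t))` costs
  `(nlp)^(ω/3) ≤ κ N^ω t^k` (`HostingBound`, `R̃(⟨N,N,N⟩ ⊠ T) ≤ N^ω R̃(T)`, border rank of truncated polynomial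
  rings).

The composition is exponent bookkeeping over `ℝ`:
`κ N^ω t^k ≤ κ (c (s+1)^A)^ω · c (s+1)^b = (κ c^ω c) (s+1)^(A ω + b)`, `A = (D - b)/2`.
-/

set_option linter.dupNamespace false

noncomputable section

namespace Summit.MatrixMultiplication.MatrixMultiplication.Theorems

open scoped BigOperators Matrix

/-- **`UnitriangularCostShape`** (crux `stmt-MatrixMultiplication-7724` of route `NilpotentLieHosts`): for every
`d ≥ 3` there are `b > 0` and `C` such that every TPP triple `X, Y, Z ⊂ U_d(ℤ)` with separating polynomials of
`(j-i)`-weighted degree `≤ s` satisfies `(|X||Y||Z|)^(ω/3) ≤ C (s+1)^(((d(d-1)/2 - b)/2)·ω + b)`.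
Proof: product model ∘ hosting ∘ cost of the truncated matrix host, then exponent bookkeeping. -/
theorem unitriangularCostShape_proof :
    Summit.MatrixMultiplication.MatrixMultiplication.Theses.NilpotentLieHosts.UnitriangularCostShape := by
  intro d hd
  obtain ⟨b, hb, k, c, hc, hmodel⟩ := UnitriangularCostShape.stub_productModel d hd
  obtain ⟨κ, hκ, hcostk⟩ := UnitriangularCostShape.stub_truncatedMatrixCost k
  refine ⟨b, hb, κ * c ^ Literature.Computability.AlgebraicComplexity.omega ℂ * c, ?_⟩
  intro s X Y Z hU _hT hS
  obtain ⟨t, N, hN, ht, ρ, hρ⟩ := hmodel s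
  obtain ⟨α, β, γ, hhost⟩ := UnitriangularCostShape.stub_modelHosts d k t N s ρ X Y Z hρ hU hS
  have hcost := hcostk t N X.card Y.card Z.card α β γ hhost
  set w : ℝ := Literature.Computability.AlgebraicComplexity.omega ℂ with hw
  set A : ℝ := ((d : ℝ) * (d - 1) / 2 - b) / 2 with hA
  have hw0 : 0 ≤ w :=
    zero_le_two.trans (Literature.Computability.AlgebraicComplexity.omega_two_le ℂ)
  have hs0 : (0 : ℝ) < (s : ℝ) + 1 := by positivity
  have hsA : (0 : ℝ) ≤ ((s : ℝ) + 1) ^ A := Real.rpow_nonneg hs0.le A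
  have hcw : (0 : ℝ) ≤ c ^ w := Real.rpow_nonneg hc.le w
  have h1 : (N : ℝ) ^ w ≤ c ^ w * ((s : ℝ) + 1) ^ (A * w) :=
    calc (N : ℝ) ^ w ≤ (c * ((s : ℝ) + 1) ^ A) ^ w := Real.rpow_le_rpow (Nat.cast_nonneg N) hN hw0
      _ = c ^ w * (((s : ℝ) + 1) ^ A) ^ w := Real.mul_rpow hc.le hsA
      _ = c ^ w * ((s : ℝ) + 1) ^ (A * w) := by rw [Real.rpow_mul hs0.le]
  have h2 : (N : ℝ) ^ w * (t : ℝ) ^ k ≤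
      (c ^ w * ((s : ℝ) + 1) ^ (A * w)) * (c * ((s : ℝ) + 1) ^ b) :=
    mul_le_mul h1 ht (by positivity) (mul_nonneg hcw (Real.rpow_nonneg hs0.le _))
  have h3 : κ * ((c ^ w * ((s : ℝ) + 1) ^ (A * w)) * (c * ((s : ℝ) + 1) ^ b)) =
      κ * c ^ w * c * ((s : ℝ) + 1) ^ (A * w + b) := by
    rw [Real.rpow_add hs0]
    ring
  have hcard : ((X.card * Y.card * Z.card : ℕ) : ℝ) = (X.card : ℝ) * Y.card * Z.card := by
    simp only [Nat.cast_mul]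
  calc ((X.card : ℝ) * Y.card * Z.card) ^ (w / 3)
      = ((X.card * Y.card * Z.card : ℕ) : ℝ) ^ (w / 3) := by rw [hcard]
    _ ≤ κ * (N : ℝ) ^ w * (t : ℝ) ^ k := hcost
    _ = κ * ((N : ℝ) ^ w * (t : ℝ) ^ k) := by ring
    _ ≤ κ * ((c ^ w * ((s : ℝ) + 1) ^ (A * w)) * (c * ((s : ℝ) + 1) ^ b)) :=
      mul_le_mul_of_nonneg_left h2 hκ.le
    _ = κ * c ^ w * c * ((s : ℝ) + 1) ^ (A * w + b) := h3

end Summit.MatrixMultiplication.MatrixMultiplication.Theorems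

end
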